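import Mathlib

/-!
# Transport of the head flux between heights (Green's formula; 2½-D no-go)

Planar picture of an `x`-independent steady Euler witness on the open half-plane `{(y, z) : z > 0}`:
`ψ` is the stream function (`∂_y ψ = −w`, `∂_z ψ = v`), `(v, w)` the planar velocity with
`∂_y v + ∂_z w = 0`, and `b` the head with Bernoulli's relation `v ∂_y b + w ∂_z b = 0`, all of class `C¹`
and `1`-periodic in `y`.  For every `C¹` function `f : ℝ → ℝ` the planar field
`(P, R) := (f (ψ) b v, f (ψ) b w)` is divergence free:

  `∂_y P + ∂_z R = f'(ψ) b (ψ_y v + ψ_z w) + f(ψ) (b_y v + b_z w) + f(ψ) b (v_y + w_z) = 0`,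

so Green's formula on the rectangle `[0,1] × [h,1]` (`0 < h ≤ 1`) together with the periodicity
`P (1, z) = P (0, z)` gives `∫₀¹ R (y, 1) dy = ∫₀¹ R (y, h) dy`: the head flux `∫₀¹ f(ψ) b w dy` does not
depend on the height.

This is the tool stub `stub_headFluxTransport` of the line `Sketch` of the crux `HalfSpaceHierarchy`
(route `DyadicWallCascade`).
-/

set_option linter.dupNamespace false

namespace Summit.AnomalousDissipation.AnomalousDissipation.Theorems.HalfSpaceHierarchy

open MeasureTheory Set

/-- On the open upper half-plane a `C¹` function has its Fréchet derivative at every point. -/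
private lemma headFlux_hasFDerivAt_of_contDiffOn {g : ℝ × ℝ → ℝ}
    (hg : ContDiffOn ℝ 1 g {p : ℝ × ℝ | 0 < p.2}) (p : ℝ × ℝ) (hp : 0 < p.2) :
    HasFDerivAt g (fderiv ℝ g p) p :=
  ((hg.differentiableOn one_ne_zero p hp).differentiableAt
    ((isOpen_lt continuous_const continuous_snd).mem_nhds hp)).hasFDerivAt

/-- Product/chain rule: the derivative of `q ↦ f (ψ q) * b q * g q` at a point of the open upper
half-plane, for `f` of class `C¹` on `ℝ` and `ψ, b, g` of class `C¹` on the half-plane. -/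
private lemma headFlux_hasFDerivAt_prod {ψ b g : ℝ × ℝ → ℝ} {f : ℝ → ℝ} (hf : ContDiff ℝ 1 f)
    (hψ : ContDiffOn ℝ 1 ψ {p : ℝ × ℝ | 0 < p.2}) (hb : ContDiffOn ℝ 1 b {p : ℝ × ℝ | 0 < p.2})
    (hg : ContDiffOn ℝ 1 g {p : ℝ × ℝ | 0 < p.2}) (p : ℝ × ℝ) (hp : 0 < p.2) :
    HasFDerivAt (fun q => f (ψ q) * b q * g q)
      ((f (ψ p) * b p) • fderiv ℝ g p +
        g p • (f (ψ p) • fderiv ℝ b p + b p • (deriv f (ψ p) • fderiv ℝ ψ p))) p := by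
  have hfψ : HasFDerivAt (fun q => f (ψ q)) (deriv f (ψ p) • fderiv ℝ ψ p) p :=
    ((hf.differentiable one_ne_zero) _).hasDerivAt.comp_hasFDerivAt p
      (headFlux_hasFDerivAt_of_contDiffOn hψ p hp)
  exact (hfψ.fun_mul (headFlux_hasFDerivAt_of_contDiffOn hb p hp)).fun_mul
    (headFlux_hasFDerivAt_of_contDiffOn hg p hp)

/-- **Transport of the head flux between heights** (tool stub `stub_headFluxTransport`).
On the open half-plane `{(y, z) : z > 0}` let `ψ, b, v, w` be `C¹` with `∂_y ψ = −w`, `∂_z ψ = v`,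
`∂_y v + ∂_z w = 0`, `v ∂_y b + w ∂_z b = 0`, and `ψ, b, v` `1`-periodic in `y` on `0 < z ≤ 1`.  Then for
every `C¹` function `f` and every height `0 < h ≤ 1`,
`∫₀¹ f (ψ (y,1)) b (y,1) w (y,1) dy = ∫₀¹ f (ψ (y,h)) b (y,h) w (y,h) dy`
(Green's formula for the divergence-free field `(f(ψ) b v, f(ψ) b w)` on `[0,1] × [h,1]`). -/
theorem stub_headFluxTransport :
    ∀ (ψ b v w : ℝ × ℝ → ℝ) (f : ℝ → ℝ) (h : ℝ), 0 < h → h ≤ 1 → ContDiff ℝ 1 f →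
      ContDiffOn ℝ 1 ψ {p : ℝ × ℝ | 0 < p.2} → ContDiffOn ℝ 1 b {p : ℝ × ℝ | 0 < p.2} →
      ContDiffOn ℝ 1 v {p : ℝ × ℝ | 0 < p.2} → ContDiffOn ℝ 1 w {p : ℝ × ℝ | 0 < p.2} →
      (∀ p : ℝ × ℝ, 0 < p.2 → fderiv ℝ ψ p (1, 0) = - w p ∧ fderiv ℝ ψ p (0, 1) = v p) →
      (∀ p : ℝ × ℝ, 0 < p.2 → fderiv ℝ v p (1, 0) + fderiv ℝ w p (0, 1) = 0) →
      (∀ p : ℝ × ℝ, 0 < p.2 → v p * fderiv ℝ b p (1, 0) + w p * fderiv ℝ b p (0, 1) = 0) →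
      (∀ z : ℝ, 0 < z → z ≤ 1 → ψ (1, z) = ψ (0, z) ∧ b (1, z) = b (0, z) ∧ v (1, z) = v (0, z)) →
      ∫ y in (0 : ℝ)..1, f (ψ (y, 1)) * b (y, 1) * w (y, 1) =
        ∫ y in (0 : ℝ)..1, f (ψ (y, h)) * b (y, h) * w (y, h) := by
  intro ψ b v w f h hh hh1 hf hψ hb hv hw hgrad hdiv hbern hper
  -- explicit derivatives of `P := f ∘ ψ * b * v` and `R := f ∘ ψ * b * w`
  obtain ⟨Pd, hPd_def⟩ : ∃ Pd : ℝ × ℝ → (ℝ × ℝ →L[ℝ] ℝ), Pd = fun p =>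
      (f (ψ p) * b p) • fderiv ℝ v p +
        v p • (f (ψ p) • fderiv ℝ b p + b p • (deriv f (ψ p) • fderiv ℝ ψ p)) := ⟨_, rfl⟩
  obtain ⟨Rd, hRd_def⟩ : ∃ Rd : ℝ × ℝ → (ℝ × ℝ →L[ℝ] ℝ), Rd = fun p =>
      (f (ψ p) * b p) • fderiv ℝ w p +
        w p • (f (ψ p) • fderiv ℝ b p + b p • (deriv f (ψ p) • fderiv ℝ ψ p)) := ⟨_, rfl⟩
  have hPd : ∀ p : ℝ × ℝ, 0 < p.2 → HasFDerivAt (fun q => f (ψ q) * b q * v q) (Pd p) p := by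
    intro p hp
    rw [hPd_def]
    exact headFlux_hasFDerivAt_prod hf hψ hb hv p hp
  have hRd : ∀ p : ℝ × ℝ, 0 < p.2 → HasFDerivAt (fun q => f (ψ q) * b q * w q) (Rd p) p := by
    intro p hp
    rw [hRd_def]
    exact headFlux_hasFDerivAt_prod hf hψ hb hw p hp
  -- the divergence vanishes identically on the half-plane
  have hdiv0 : ∀ p : ℝ × ℝ, 0 < p.2 → Pd p (1, 0) + Rd p (0, 1) = 0 := by
    intro p hp
    rw [hPd_def, hRd_def]
    simp only [add_apply, smul_apply, smul_eq_mul]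
    linear_combination (f (ψ p) * b p) * hdiv p hp + f (ψ p) * hbern p hp +
      (b p * deriv f (ψ p) * v p) * (hgrad p hp).1 + (b p * deriv f (ψ p) * w p) * (hgrad p hp).2
  -- the rectangle `[0,1] × [h,1]` lies in the half-plane
  have hle : ((0 : ℝ), h) ≤ ((1 : ℝ), (1 : ℝ)) := ⟨zero_le_one, hh1⟩
  have hIcc : ∀ p ∈ Icc ((0 : ℝ), h) ((1 : ℝ), (1 : ℝ)), 0 < p.2 := fun p hp =>
    lt_of_lt_of_le hh hp.1.2
  have hIoo : ∀ p ∈ Ioo ((0 : ℝ), h).1 ((1 : ℝ), (1 : ℝ)).1 ×ˢ Ioo ((0 : ℝ), h).2 ((1 : ℝ), (1 : ℝ)).2,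
      0 < p.2 := fun p hp => lt_trans hh hp.2.1
  -- continuity of `P` and `R` on the rectangle
  have hcont : ∀ {g : ℝ × ℝ → ℝ}, ContDiffOn ℝ 1 g {p : ℝ × ℝ | 0 < p.2} →
      ContinuousOn (fun q => f (ψ q) * b q * g q) (Icc ((0 : ℝ), h) ((1 : ℝ), (1 : ℝ))) :=
    fun hg => (((hf.continuous.comp_continuousOn hψ.continuousOn).mul hb.continuousOn).mul
      hg.continuousOn).mono hIcc
  -- the divergence is integrable on the rectangle (it is zero there)
  have hHi : IntegrableOn (fun p => Pd p (1, 0) + Rd p (0, 1)) (Icc ((0 : ℝ), h) ((1 : ℝ), (1 : ℝ))) :=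
    integrableOn_zero.congr_fun (fun p hp => (hdiv0 p (hIcc p hp)).symm) measurableSet_Icc
  -- Green's formula on the rectangle
  have hG : (∫ x in Icc ((0 : ℝ), h) ((1 : ℝ), (1 : ℝ)), Pd x (1, 0) + Rd x (0, 1)) =
      (((∫ x in (0 : ℝ)..1, f (ψ (x, 1)) * b (x, 1) * w (x, 1)) -
          ∫ x in (0 : ℝ)..1, f (ψ (x, h)) * b (x, h) * w (x, h)) +
        ∫ y in h..1, f (ψ (1, y)) * b (1, y) * v (1, y)) -
      ∫ y in h..1, f (ψ (0, y)) * b (0, y) * v (0, y) :=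
    integral_divergence_prod_Icc_of_hasFDerivAt_of_le (fun q => f (ψ q) * b q * v q)
      (fun q => f (ψ q) * b q * w q) Pd Rd ((0 : ℝ), h) ((1 : ℝ), (1 : ℝ)) hle (hcont hv) (hcont hw)
      (fun p hp => hPd p (hIoo p hp)) (fun p hp => hRd p (hIoo p hp)) hHi
  -- the left-hand side vanishes
  have hL : (∫ x in Icc ((0 : ℝ), h) ((1 : ℝ), (1 : ℝ)), Pd x (1, 0) + Rd x (0, 1)) = 0 :=
    setIntegral_eq_zero_of_forall_eq_zero fun p hp => hdiv0 p (hIcc p hp)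
  -- the lateral terms cancel by periodicity
  have hlat : ∫ y in h..1, f (ψ (1, y)) * b (1, y) * v (1, y) =
      ∫ y in h..1, f (ψ (0, y)) * b (0, y) * v (0, y) := by
    apply intervalIntegral.integral_congr
    intro z hz
    rw [uIcc_of_le hh1] at hz
    obtain ⟨h1, h2, h3⟩ := hper z (lt_of_lt_of_le hh hz.1) hz.2
    simp only [h1, h2, h3]
  rw [hL] at hG
  linarith [hG, hlat]

end Summit.AnomalousDissipation.AnomalousDissipation.Theorems.HalfSpaceHierarchy
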